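import Summits.KontsevichZagierPeriods.Zeta5Search.RVPeriodicShiftCasLB
import Summits.KontsevichZagierPeriods.Zeta5Search.Certificates.RayC1KernelClassLowKind
import HarnessLib

/-!
# ζ(5) search — RHIN–VIOLA PERIODICITY BELOW `θ = 1` on the ray C1: the periodic window normal form and the shift laws (fam-rv g17)

HONEST FRAMING: systematic search; no irrationality claim unless certified.  `p`-adic bookkeeping of explicit integers attached to
the ray `b(n) = n·(85; 35,32,30,27,25,22,20)`; nothing about `ζ(5)`; every exponent this could ever feed is `< 1`.

OUR work (Summit side; family-designer seat `fam-rv`, generation 17).  Below `θ = p/n = 1` write `n = m·p + s`, `0 < s < p`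
(`m = ⌊n/p⌋ ≥ 1`, `ω = s/p = {n/p}`).  The Rhin–Viola mechanism for a ray with INTEGER slopes is the action of the translation
`n ↦ n + p` (`b ↦ b + p·β`): every class datum of `ClusterValuation` (class exponents, pole counts, the Casoratian class bound `casLB`,
the guards of the bonus laws) is a function of the residue arrangement of `{β_k ω}` alone, up to an AFFINE term in `m` whose slope is a
weight of the ray (`−128` per coefficient, `−256` for the Casoratian, `+41` poles per class).  Consequences:
* `PWin` / `PWin.Holds` — the PERIODIC window normal form: ONE statement per `ω`-cell `u ≤ {n/p} < v`, for EVERY shift `m ≥ 1`, with the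
  bound `B(m) = B₁ − 256·m`; `PWin.holdsLow_win` instantiates it at any `m` as a `CWin.HoldsLow` window of the typer's kind-4 consumer
  (`RayC1KernelClassLowKind`), so periodic faces are consumable today, shift by shift, and by a digamma / truncated-step-factor consumer for
  all `m` at once later;
* the SHIFT LAWS as named statements (`ClassExpShiftLaw`, `PoleCountShiftLaw`, `CasLBShiftLaw`) with kernel-checked instances.
Proofs of the shift laws: `RVPeriodicShift` (class exponents `−128`, pole counts `+41`, every odd prime, no window hypothesis) and
`RVPeriodicShiftCasLB` (`LB − 256` below `θ = 1`); here they are re-exported under the typed names (`classExpShiftLaw_holds`, …).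
-/

namespace Summit.KontsevichZagierPeriods.Zeta5Search.RVPeriodic

open Finset
open Summit.KontsevichZagierPeriods.Zeta5Search.RayC1
open Summit.KontsevichZagierPeriods.Zeta5Search.ClusterValuation
open Summit.KontsevichZagierPeriods.Zeta5Search.CasoratianValuation (casoratian)

/-! ## §1 The periodic window normal form -/

/-- A PERIODIC CLASS-LAW WINDOW of the ray C1 below `θ = 1`: the `ω`-cell `u₁/u₂ ≤ {n/p} < v₁/v₂`, valid from `n ≥ N0`, with the
periodic part `B1` of the Casoratian floor (`B(m) = B1 − 256·m` at shift `m = ⌊n/p⌋`). -/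
structure PWin where
  /-- cell left endpoint numerator -/
  u1 : ℕ
  /-- cell left endpoint denominator -/
  u2 : ℕ
  /-- cell right endpoint numerator -/
  v1 : ℕ
  /-- cell right endpoint denominator -/
  v2 : ℕ
  /-- least `n` -/
  N0 : ℕ
  /-- periodic part of the bound: `B1 − 256·m ≤ v_p(Cas₇(b(n)))` -/
  B1 : ℤ

/-- The statement a periodic window stands for: for EVERY shift `m ≥ 1` and every prime of the cell
(`(m·u₂ + u₁)·p ≤ u₂·n`, `v₂·n < (m·v₂ + v₁)·p`, single-digit range `85n + 2 < p²`), `B1 − 256·m ≤ v_p(Cas₇(b(n)))`. -/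
def PWin.Holds (c : PWin) : Prop :=
  ∀ n p m : ℕ, c.N0 ≤ n → p.Prime → 1 ≤ m → 85 * n + 2 < p * p →
    (m * c.u2 + c.u1) * p ≤ c.u2 * n → c.v2 * n < (m * c.v2 + c.v1) * p →
    casoratian (bC1 n) 7 ≠ 0 → c.B1 - 256 * (m : ℤ) ≤ padicValRat p (casoratian (bC1 n) 7)

/-- The `m`-th `θ`-window of a periodic cell, in the typer's normal form: `θ = p/n ∈ (v₂/(m·v₂+v₁), u₂/(m·u₂+u₁)]`, from
`n ≥ max N0 (86·(m+1)²)` (which puts every window prime in the single-digit range), floor `B1 − 256·m`. -/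
def PWin.win (c : PWin) (m : ℕ) : CWin :=
  ⟨c.v2, m * c.v2 + c.v1, c.u2, m * c.u2 + c.u1, max c.N0 (86 * (m + 1) ^ 2), c.B1 - 256 * (m : ℤ)⟩

/-- **Bridge to the kind-4 consumer.**  A periodic window theorem yields, at every shift `m ≥ 1`, a window theorem in the low normal form
`CWin.HoldsLow` of `RayC1KernelClassLowKind` (cell with `v₁ ≤ v₂`, i.e. `{n/p} < v ≤ 1`). -/
theorem PWin.holdsLow_win (c : PWin) (hv : c.v1 ≤ c.v2) (h : c.Holds) {m : ℕ} (hm : 1 ≤ m) :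
    (c.win m).HoldsLow := by
  intro n p hn hp h1 h2 _ hne
  simp only [PWin.win] at hn h1 h2 ⊢
  have hN0 : c.N0 ≤ n := le_trans (le_max_left _ _) hn
  have h86 : 86 * (m + 1) ^ 2 ≤ n := le_trans (le_max_right _ _) hn
  -- `n < (m+1)·p` from the left end of the window
  have hlt : c.v2 * n < c.v2 * ((m + 1) * p) := by
    have : (m * c.v2 + c.v1) * p ≤ (m * c.v2 + c.v2) * p := Nat.mul_le_mul_right _ (by omega)
    have h' : (m * c.v2 + c.v2) * p = c.v2 * ((m + 1) * p) := by ring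
    omega
  have hnp : n < (m + 1) * p := Nat.lt_of_mul_lt_mul_left hlt
  -- hence `p > 86·(m+1)` and `p² > 86·n ≥ 85·n + 2`
  have hp86 : 86 * (m + 1) < p := by
    by_contra hc
    push Not at hc
    have : (m + 1) * p ≤ (m + 1) * (86 * (m + 1)) := Nat.mul_le_mul_left _ hc
    have h' : (m + 1) * (86 * (m + 1)) = 86 * (m + 1) ^ 2 := by ring
    omega
  have hsq : 85 * n + 2 < p * p := by
    have h3 : 86 * (m + 1) * p < p * p := Nat.mul_lt_mul_of_pos_right hp86 hp.pos
    have h4 : 86 * n < 86 * ((m + 1) * p) := by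
      have := Nat.mul_lt_mul_of_pos_left hnp (show 0 < 86 by norm_num); simpa [mul_comm, mul_left_comm, mul_assoc] using this
    have h5 : 86 * ((m + 1) * p) = 86 * (m + 1) * p := by ring
    have h6 : 2 ≤ n := by nlinarith
    omega
  exact h n p m hN0 hp hm hsq h2 h1 hne

/-! ## §2 The shift laws (statements; proofs in `RVPeriodicShift`) -/

/-- **SHIFT LAW FOR CLASS EXPONENTS**: translating `n` by `p` lowers EVERY class exponent by the coefficient weight `128`
(`= Σ_j (85 − 2β_j) − 85`), for every odd prime `p` and every residue `x` — no window hypothesis at all. -/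
def ClassExpShiftLaw : Prop :=
  ∀ n p x : ℕ, p.Prime → p ≠ 2 → classExp (bC1 (n + p)) p x = classExp (bC1 n) p x - 128

/-- **SHIFT LAW FOR POLE COUNTS**: translating `n` by `p` adds exactly `41 = 63 − 22` poles to every class. -/
def PoleCountShiftLaw : Prop :=
  ∀ n p x : ℕ, p.Prime → p ≠ 2 → classPoleCount (bC1 (n + p)) p x = classPoleCount (bC1 n) p x + 41

/-- **SHIFT LAW FOR THE CASORATIAN CLASS BOUND** (letters `M`): below `θ = 1` (`p ≤ n`, where every class is a multipole class and
`p ≤ d = 64n`) the class bound `casLB = VB + rowMin` drops by exactly `256` per shift. -/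
def CasLBShiftLaw : Prop :=
  ∀ n p : ℕ, p.Prime → p ≠ 2 → p ≤ n → casLB (bC1 (n + p)) p = casLB (bC1 n) p - 256

/-- The class-exponent shift law holds (from `classExp_shift`). -/
theorem classExpShiftLaw_holds : ClassExpShiftLaw := fun n p x hp hp2 => by
  haveI := Fact.mk hp
  exact classExp_shift hp2 n x

/-- The pole-count shift law holds (from `classPoleCount_shift`). -/
theorem poleCountShiftLaw_holds : PoleCountShiftLaw := fun n p x hp _ => by
  haveI := Fact.mk hp
  exact classPoleCount_shift n x

/-- The `casLB` shift law holds (from `casLB_shift`). -/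
theorem casLBShiftLaw_holds : CasLBShiftLaw := fun n p hp hp2 hpn => by
  haveI := Fact.mk hp
  exact casLB_shift hp2 n hpn

/-! ## §3 A kernel-checked instance (`decide +kernel`, smoke test of the definitions against the law): `p = 3`, `n = 1 → 4`.
(In scratch the instances `classExp` `n = 2 → 5`, `classPoleCount` `n = 1 → 4` and `casLB` `n = 3 → 6` were kernel-checked too; they sit at the
edge of the kernel's recursion budget and are not repeated here — the laws are proved above for every `n`, `p`.) -/

example : ∀ x ∈ [0, 1, 2], classExp (bC1 (1 + 3)) 3 x = classExp (bC1 1) 3 x - 128 := by decide +kernel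

end Summit.KontsevichZagierPeriods.Zeta5Search.RVPeriodic
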